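import Summits.CriticalPhenomena.PercolationContinuityZ3.Theorems.Transplant.SkelFrmBChoiceRadii
import Summits.CriticalPhenomena.PercolationContinuityZ3.Theorems.Transplant.SkelFrmBParamsSlotsTA
import Summits.CriticalPhenomena.PercolationContinuityZ3.Theorems.Transplant.SkelFrmBParamsKitS
import HarnessLib

/-!
# N2 (frames-only node `SamePDropOfSkeletonFrm₁`, OPEN), WAVE 1 VALUE ROWS: the short-region radius against the cells and the cube at the BOX SLOT OF RECORD `gT` —
# `RA'_le_r_TA`, **`hRs5_TA`** (`Rs + 1 ≤ 5·r_i`), and the `ex`-floor forms `hRsQ_of_le_ex` / `hRsR_of_le_ex` (p3-g16's row table 2026-08-23T03:36:36Z)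

Twin of N1's `SkelNegBParamsRootAA.RA'_le_r_TA` over `PlanarSkeletonFrm`/`DataNS` (the (ζ′) cells `fcellsA` at `g := KS.gT mk gx`: `K·Kq·(6RA′+11) ≤ r₀`, `K·Kq·(14RA′+27) ≤ r₁`,
SlotsTA `r_geTA` ✓), whence `KS.RA′ ≤ r_i` and — since `KS.Rs + 2 < KS.RA′` (KitS `T₀a_lt_RA'`) — the root-cell row **`hRs5 : ∀ i, KS.Rs + 1 ≤ 5·(fcellsS …).r i`** for every
creep value (`fcellsS.toPCells2 = fcellsA`).  The cube/window rows `hRsQ : Rs + 2 ≤ rQ 0 0`, `hRsR : Rs ≤ R (:= rQ α x)`, `hRLQ : RL + 2 ≤ rQ 0 0` are floors on the residual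
`ex` of the block `SUS ex mx` through `le_rQ_of_le_ex` (ChoiceRadii); stated here by name for the two `Rs` rows.
builds on p205010 (kernel theorem, internal audit signed; external expert review pending) — nothing in this file uses p205010; NOTHING is claimed about the open node
`SamePDropOfSkeletonFrm₁` (`SamePDropOfSkeletonNeg₁` is CLOSED in the tree and untouched by this file).
Lane `prim-bschramm`, seat `prim-bschramm-stmt` (gen 20); helper file (`--supports stmt-CriticalPhenomena-4575 --as helper`).
[cite: KozmaNitzan2024, §4 Theorem 6 (pp. 25–31): the order of constants; p. 28 ((32))] [cite: MartineauTassion2017, §4.3]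
-/

noncomputable section

open scoped Classical

namespace Summit.CriticalPhenomena.PercolationContinuityZ3.Theorems.Transplant

namespace PlanarSkeletonFrm

namespace NegB

open Literature.Probability.Percolation Literature.Probability.LatticeModels SimpleGraph
open SkelConc (Consts)
open Neg

section AtT

variable (κ : Consts) {V : Type} [DecidableEq V] [Countable V] {G : SimpleGraph V} [G.LocallyFinite] (Φ : PlanarSkeletonFrm G) (t : V)
  (p : unitInterval) (D : Skelφ.StepI.DataNS V) (mk : ℕ) (gx : Neg.FSlot) (f : ℕ) (c : Fin 2 → ℕ)

/-- **`RA′ ≤ r_i`** at `g := gT` (`K ≥ 40`, `Kq ≥ 1`, `K·Kq·(6RA′+11) ≤ r₀`, `K·Kq·(14RA′+27) ≤ r₁`). [folklore] -/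
theorem RA'_le_r_TA (hN : EqNumL κ Φ t p D (KS.gT mk gx κ Φ t p D) f) (hκ : (hL κ Φ t p D (KS.gT mk gx κ Φ t p D) f).natAbs ≤ 10 * nL κ Φ t p D (KS.gT mk gx κ Φ t p D) f) :
    ∀ i, (KS.RA' κ Φ t p D mk : ℤ) ≤ ((fcellsA κ Φ t p D (KS.gT mk gx κ Φ t p D) f).r i : ℤ) := by
  obtain ⟨h0, h1⟩ := KS.r_geTA κ Φ t p D mk gx f hN hκ
  have hK : (40 : ℤ) ≤ Neg.K κ := by exact_mod_cast (Neg.forty_le_K κ).1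
  have hR : (0 : ℤ) ≤ (KS.RA' κ Φ t p D mk : ℤ) := by positivity
  have hq : (1 : ℤ) ≤ Neg.Kq κ := by exact_mod_cast Neg.one_le_Kq κ
  have h6 : (1 : ℤ) * (6 * (KS.RA' κ Φ t p D mk : ℤ) + 11) ≤ (Neg.Kq κ : ℤ) * (6 * (KS.RA' κ Φ t p D mk : ℤ) + 11) := mul_le_mul_of_nonneg_right hq (by linarith)
  have h14 : (1 : ℤ) * (14 * (KS.RA' κ Φ t p D mk : ℤ) + 27) ≤ (Neg.Kq κ : ℤ) * (14 * (KS.RA' κ Φ t p D mk : ℤ) + 27) := mul_le_mul_of_nonneg_right hq (by linarith)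
  have h0' := mul_le_mul_of_nonneg_left h6 (by linarith : (0 : ℤ) ≤ Neg.K κ)
  have h1' := mul_le_mul_of_nonneg_left h14 (by linarith : (0 : ℤ) ≤ Neg.K κ)
  intro i
  obtain rfl | rfl : i = 0 ∨ i = 1 := by fin_cases i <;> simp
  · nlinarith
  · nlinarith

/-- **`hRs5`: `Rs + 1 ≤ 5·r_i`** (indeed `Rs + 3 ≤ r_i`) at `g := gT`, for the staggered cells `fcellsS … c` (any creep value). [folklore] -/
theorem hRs5_TA (hN : EqNumL κ Φ t p D (KS.gT mk gx κ Φ t p D) f) (hκ : (hL κ Φ t p D (KS.gT mk gx κ Φ t p D) f).natAbs ≤ 10 * nL κ Φ t p D (KS.gT mk gx κ Φ t p D) f) :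
    ∀ i, KS.Rs t D mk + 1 ≤ 5 * (fcellsS κ Φ t p D (KS.gT mk gx κ Φ t p D) f c).r i := by
  intro i
  have h1 := RA'_le_r_TA κ Φ t p D mk gx f hN hκ i
  have h2 := (KS.T₀a_lt_RA' κ Φ t p D mk).2.1
  rw [fcellsS_r]
  have h3 : (KS.Rs t D mk : ℤ) + 2 < ((fcellsA κ Φ t p D (KS.gT mk gx κ Φ t p D) f).r i : ℤ) := lt_of_lt_of_le (by exact_mod_cast h2) h1
  omega

end AtT

section AtSUS

variable (κ : Consts) {V : Type} [DecidableEq V] [Countable V] {G : SimpleGraph V} [G.LocallyFinite] (Φ : PlanarSkeletonFrm G) (t : V)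
  (p : unitInterval) (D : Skelφ.StepI.DataNS V) (g f : ℕ) (c : Fin 2 → ℕ) (mk : ℕ) (ex mx : GSlot) (q : unitInterval)

/-- **`hRsQ` as a floor on `ex`**: `Rs + 2 ≤ ex → Rs + 2 ≤ rQ 0 0` at the schedule of record. [folklore] -/
theorem hRsQ_of_le_ex (h : KS.Rs t D mk + 2 ≤ ex κ Φ t p D g f) :
    KS.Rs t D mk + 2 ≤ (schedOfS κ Φ t p D g f c (SUS ex mx κ Φ t p D g f q)).rQ 0 0 :=
  le_rQ_of_le_ex κ Φ t p D g f c ex mx q h 0 0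

/-- **`hRsR` as a floor on `ex`**: `Rs ≤ ex → Rs ≤ rQ a x` (the corridor window radius `R := rQ α x`). [folklore] -/
theorem hRsR_of_le_ex (h : KS.Rs t D mk ≤ ex κ Φ t p D g f) (a : ℕ) (x : Site 2) :
    KS.Rs t D mk ≤ (schedOfS κ Φ t p D g f c (SUS ex mx κ Φ t p D g f q)).rQ a x :=
  le_rQ_of_le_ex κ Φ t p D g f c ex mx q h a x

end AtSUS

end NegB

end PlanarSkeletonFrm

end Summit.CriticalPhenomena.PercolationContinuityZ3.Theorems.Transplant

end
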